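import Literature.NumberTheory.Automorphic.UnitaryGroupEllipticFamilyIsQuotientTwo
import Literature.NumberTheory.Automorphic.UnitaryGroupOrbitalMeasureFamilyOfLocalAdelic
import HarnessLib

/-!
# The kit's adelic orbital families `ofLocal` ∕ `ofLocalAdelic` of `U(H)` ARE Weil quotients `dν ∕ dt_γ` — at every class for anisotropic `H`,
# at the ELLIPTIC classes for the quasi-split `U(J₃)`, `U(J₂)`
(Rogawski (1990), §4.3 p. 44, §5.4 (5.4.3) pp. 71–73, §14.5 pp. 237–238; Deitmar–Echterhoff (2014), Thm. 1.5.3; Gelbart (1975), (9.13))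

Topic `NumberTheory/Automorphic`; namespace `Literature.NumberTheory.Automorphic.UnitaryGroup`.  THEOREMS ONLY (no definition, no instance, no named fact,
no notation, no `sorry`).  Cell `pub/hodgecm-mathlib`, ENGINE T1 line `Cruxes/H413/Lines/F0_T1InnerFormTraceIdentity.lean` (crux H413 = item
`stmt-HodgeConjecture-24833`), row **(G2) (R1) «the `ofLocal` READING»** (A-p16 (g23) census `CENSUS-G2-OfLocalIsQuotient` (R1)∕(R2); T6 desk 16:40:18Z;
F0P3a-p03 (g7)): the composition of ★ `UnitaryGroupEllipticFamilyIsQuotient[Two]` («an ADMISSIBLE family along `toAdelic` is a family of Weil quotients on the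
classes with unimodular centralisers») with the admissibility of the families the ENGINE's kit actually anchors — ★ `AdelicOrbitalMeasureFamily.ofLocal mG mGi`
(rational-class-indexed, ★ `ofLocal_admissible`) and ★ `OrbitalMeasureFamily.ofLocalAdelic mG mGi` (adelic-class-indexed, ★ `ofLocalAdelic_admissible`, read
at the rational points through ★ `OrbitalMeasureFamily.atPoint`) — built from local class-indexed orbital measure families `mG v`, `mGi` that are
admissible at the local classes of `γ_c·1` and normalised off a finite set of places (★ `IsNormalisedOff`; for CANONICAL local families these riders are ★
`exists_isNormalisedOff_of_isCanonical` ∕ `isAdmissibleOn_at_toLocal_toAdelic` at the regular classes, and the (ADM)(NORM) clauses of the singular package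
elsewhere — supplied by the caller, as in ★ `UnitaryGroupAbsorbedFamilyOfLocalAllClasses`).

* §1 (any `U(H)`, `cmDatum L N H` letters, class guard `P` with inversion-invariant centraliser Haar measures on `P`):
  **`exists_haarFamily_ofLocal_eq_quotientMeasure_on`** — `∃ t` TOTAL Haar, `∀ c, P c → (t c).IsInvInvariant ∧ ofLocal mG mGi c = quotientMeasure
  (U(H)(𝔸)_{γ_c·1}) (t c) ν`; **`exists_haarFamily_ofLocalAdelic_atPoint_eq_quotientMeasure_on`** — the same for `(ofLocalAdelic mG mGi).atPoint (γ_c·1)`.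
* §2 (`H` ANISOTROPIC, all classes; `hinv` = ★ `isInvInvariant_centralizer_cmDatum`): **`exists_haarFamily_ofLocal_eq_quotientMeasure_of_anisotropic`**
  (+ right invariance ★ `isMulRightInvariant_centralizer_cmDatum`) — the `ofLocal` reading of ★ `UnitaryGroup.exists_haarFamily_eq_quotientMeasure`.
* §3 (the QUASI-SPLIT `U(J₃) = cmDatum L 3 ((StdForm.antidiagonal 3).over L) = quasiSplit L⁺ L c 3`, ★ `quasiSplit_eq_cmDatum` `rfl`; ELLIPTIC guard of the
  kit-currency laws `∀ β ∈ B(L⁺), cl β ≠ cl (γ_c·1)`): **`exists_haarFamily_ofLocal_eq_quotientMeasure_of_forall_cl_ne_cm`** — `∃ νR` TOTAL Haar, and at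
  every elliptic `c`: right ∕ inversion invariance of `νR c` and `ofLocal L 3 Φ₃ mq mqi c = quotientMeasure (G(𝔸)_{γ_c·1}) (νR c) ν` = THE `hm` TERM of ★
  `…ThreeSocketsClosedKit` ∕ `…ExplicitCMKit` ∕ `…EllipticKit` at `m := ofLocal … mq mqi`.
* §4 (`U(J₂)`, the `U(Φ₂)` factor of `H = U(Φ₂) × U(Φ₁)`): **`exists_haarFamily_ofLocal_eq_quotientMeasure_of_forall_cl_ne_cm_two`** (A-p16's (R2)).

NOT here (the complementary (G2)-T leaves of F0P3a-p02): WHICH Haar measure `νR c` is — the restricted-product TOWER `e_*(t_∞ ⊗ ∏'_v t_v)` of the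
compact-core-normalised local torus measures; by ★ `haarFamily_unique_on` the two descriptions agree for the same `ν`.  HC_CM is proved only modulo the
printed citations until rung 0 closes; this file proves no printed citation.

## References
* J. D. Rogawski, *Automorphic Representations of Unitary Groups in Three Variables*, Ann. of Math. Stud. 123 (1990), §4.3 p. 44, §5.4 (5.4.3)
  pp. 71–73, §14.5 pp. 237–238 [Rogawski1990].
* A. Deitmar, S. Echterhoff, *Principles of Harmonic Analysis*, 2nd ed. (2014), Thm. 1.5.3 [DeitmarEchterhoff2014].
* S. Gelbart, *Automorphic forms on adele groups*, Ann. of Math. Stud. 83 (1975), (9.13), Remark 9.23 [Gelbart1975].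
-/

set_option autoImplicit false
noncomputable section
open _root_.MeasureTheory _root_.MeasureTheory.Measure Set NumberField IsDedekindDomain
open _root_.Topology
open Literature.MeasureTheory.Group
open Literature.AlgebraicGeometry.ShimuraVarieties (hermForm)
open scoped ENNReal NNReal

namespace Literature.NumberTheory.Automorphic

namespace UnitaryGroup

/-! ## §1 Any `U(H)`: `ofLocal` ∕ `ofLocalAdelic` are Weil quotients on a class guard with unimodular centralisers -/

section AnyForm

variable (L : Type) [Field L] [NumberField L] [IsCMField L] (N : ℕ) (H : Matrix (Fin N) (Fin N) L)
  [MeasurableSpace (cmDatum L N H).Adelic] [BorelSpace (cmDatum L N H).Adelic]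
  [∀ g : (cmDatum L N H).Adelic, MeasurableSpace ((cmDatum L N H).Adelic ⧸ Subgroup.centralizer ({g} : Set (cmDatum L N H).Adelic))]
  [∀ g : (cmDatum L N H).Adelic, BorelSpace ((cmDatum L N H).Adelic ⧸ Subgroup.centralizer ({g} : Set (cmDatum L N H).Adelic))]
  [∀ a : arch (↥(maximalRealSubfield L)) L (IsCMField.complexConj L) N H,
    MeasurableSpace (arch (↥(maximalRealSubfield L)) L (IsCMField.complexConj L) N H ⧸
      Subgroup.centralizer ({a} : Set (arch (↥(maximalRealSubfield L)) L (IsCMField.complexConj L) N H)))]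
  [∀ a : arch (↥(maximalRealSubfield L)) L (IsCMField.complexConj L) N H,
    BorelSpace (arch (↥(maximalRealSubfield L)) L (IsCMField.complexConj L) N H ⧸
      Subgroup.centralizer ({a} : Set (arch (↥(maximalRealSubfield L)) L (IsCMField.complexConj L) N H)))]
  [∀ (v : HeightOneSpectrum (𝓞 ↥(maximalRealSubfield L))) (x : (cmDatum L N H).Local v),
    MeasurableSpace ((cmDatum L N H).Local v ⧸ Subgroup.centralizer ({x} : Set ((cmDatum L N H).Local v)))]
  [∀ (v : HeightOneSpectrum (𝓞 ↥(maximalRealSubfield L))) (x : (cmDatum L N H).Local v),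
    BorelSpace ((cmDatum L N H).Local v ⧸ Subgroup.centralizer ({x} : Set ((cmDatum L N H).Local v)))]
  (mG : ∀ v : HeightOneSpectrum (𝓞 ↥(maximalRealSubfield L)), OrbitalMeasureFamily ((cmDatum L N H).Local v))
  (mGi : OrbitalMeasureFamily (arch (↥(maximalRealSubfield L)) L (IsCMField.complexConj L) N H))
  (ν : Measure (cmDatum L N H).Adelic) [ν.IsHaarMeasure] [ν.IsMulRightInvariant]

/-- **`ofLocal mG mGi` IS A WEIL QUOTIENT `dν ∕ d(t c)` at every class of a guard `P` with unimodular centralisers.**  If at every `P`-class `c`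
(`γ = toAdelic (out c)`) the local families are admissible at the `[γ_v]` and `[γ_∞]` and normalised at `γ` off a finite `S₀ c`, and the Haar measures of the
adelic centraliser `U(H)(𝔸)_γ` are inversion invariant, then there are Haar measures `t c` on ALL the `U(H)(𝔸)_{γ_c·1}` (inversion invariant on `P`) with
`AdelicOrbitalMeasureFamily.ofLocal mG mGi c = quotientMeasure (U(H)(𝔸)_{γ_c·1}) (t c) ν` at every `P`-class: ★ `ofLocal_admissible` fed to ★
`exists_haarFamily_eq_quotientMeasure_on` along `toAdelic`. [cite: Rogawski1990, §5.4 (5.4.3) pp. 71–73] [cite: DeitmarEchterhoff2014, Thm. 1.5.3] -/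
theorem exists_haarFamily_ofLocal_eq_quotientMeasure_on (P : ConjClasses (cmDatum L N H).Rational → Prop)
    (hinv : ∀ c, P c → ∀ t : Measure ↥(Subgroup.centralizer ({(cmDatum L N H).toAdelic (Quotient.out c)} : Set (cmDatum L N H).Adelic)),
      t.IsHaarMeasure → t.IsInvInvariant)
    (S₀ : ConjClasses (cmDatum L N H).Rational → Finset (HeightOneSpectrum (𝓞 ↥(maximalRealSubfield L))))
    (hS₀ : ∀ c, P c → IsNormalisedOff L N H mG ((cmDatum L N H).toAdelic (Quotient.out c)) (S₀ c))
    (hadm : ∀ c, P c → ∀ v, mG v (ConjClasses.mk ((cmDatum L N H).toLocal v ((cmDatum L N H).toAdelic (Quotient.out c)))) ≠ 0 ∧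
      SMulInvariantMeasure ((cmDatum L N H).Local v) _ (mG v (ConjClasses.mk ((cmDatum L N H).toLocal v ((cmDatum L N H).toAdelic (Quotient.out c))))) ∧
      IsFiniteMeasureOnCompacts (mG v (ConjClasses.mk ((cmDatum L N H).toLocal v ((cmDatum L N H).toAdelic (Quotient.out c))))))
    (hadmA : ∀ c, P c →
      mGi (ConjClasses.mk (archPart (↥(maximalRealSubfield L)) L (IsCMField.complexConj L) N H ((cmDatum L N H).toAdelic (Quotient.out c)))) ≠ 0 ∧
      SMulInvariantMeasure (arch (↥(maximalRealSubfield L)) L (IsCMField.complexConj L) N H) _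
        (mGi (ConjClasses.mk (archPart (↥(maximalRealSubfield L)) L (IsCMField.complexConj L) N H ((cmDatum L N H).toAdelic (Quotient.out c))))) ∧
      IsFiniteMeasureOnCompacts
        (mGi (ConjClasses.mk (archPart (↥(maximalRealSubfield L)) L (IsCMField.complexConj L) N H ((cmDatum L N H).toAdelic (Quotient.out c)))))) :
    ∃ t : ∀ c : ConjClasses (cmDatum L N H).Rational,
        Measure ↥(Subgroup.centralizer ({(cmDatum L N H).toAdelic (Quotient.out c)} : Set (cmDatum L N H).Adelic)),
      ∃ (_ : ∀ c, (t c).IsHaarMeasure),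
        ∀ c, P c → ∃ (_ : (t c).IsInvInvariant),
          AdelicOrbitalMeasureFamily.ofLocal L N H mG mGi c =
            quotientMeasure (Subgroup.centralizer ({(cmDatum L N H).toAdelic (Quotient.out c)} : Set (cmDatum L N H).Adelic)) (t c)
              (Set.isClosed_centralizer _) ν :=
  exists_haarFamily_eq_quotientMeasure_on (cmDatum L N H).toAdelic (fun _ => Set.isClosed_centralizer _) ν P hinv
    (AdelicOrbitalMeasureFamily.ofLocal L N H mG mGi) fun c hc =>
      AdelicOrbitalMeasureFamily.ofLocal_admissible L N H mG mGi c (hS₀ c hc) (hadm c hc) (hadmA c hc)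

/-- **`(ofLocalAdelic mG mGi).atPoint (γ_c·1)` IS A WEIL QUOTIENT on the guard** — the ADELIC-class-indexed family of pins (xii″)∕(xiii″) read at the
rational points: the riders are those of ★ `ofLocalAdelic_admissible` at the adelic class `⟦γ_c·1⟧` (stated at its chosen representative `out ⟦γ_c·1⟧`, a
conjugate of `γ_c·1`; ★ `conjClassesMk_toLocal_out_eq` ∕ `conjClassesMk_archPart_out_eq` move local-class data across), fed to ★
`OrbitalMeasureFamily.exists_haarFamily_atPoint_eq_quotientMeasure_on`. [cite: Rogawski1990, §5.4 (5.4.3) pp. 71–73] [cite: Gelbart1975, (9.13)]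
[cite: DeitmarEchterhoff2014, Thm. 1.5.3] -/
theorem exists_haarFamily_ofLocalAdelic_atPoint_eq_quotientMeasure_on (P : ConjClasses (cmDatum L N H).Rational → Prop)
    (hinv : ∀ c, P c → ∀ t : Measure ↥(Subgroup.centralizer ({(cmDatum L N H).toAdelic (Quotient.out c)} : Set (cmDatum L N H).Adelic)),
      t.IsHaarMeasure → t.IsInvInvariant)
    (S₀ : ConjClasses (cmDatum L N H).Rational → Finset (HeightOneSpectrum (𝓞 ↥(maximalRealSubfield L))))
    (hS₀ : ∀ c, P c → IsNormalisedOff L N H mG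
      (Quotient.out (ConjClasses.mk ((cmDatum L N H).toAdelic (Quotient.out c))) : (cmDatum L N H).Adelic) (S₀ c))
    (hadm : ∀ c, P c → ∀ v,
      mG v (ConjClasses.mk ((cmDatum L N H).toLocal v
        (Quotient.out (ConjClasses.mk ((cmDatum L N H).toAdelic (Quotient.out c))) : (cmDatum L N H).Adelic))) ≠ 0 ∧
      SMulInvariantMeasure ((cmDatum L N H).Local v) _ (mG v (ConjClasses.mk ((cmDatum L N H).toLocal v
        (Quotient.out (ConjClasses.mk ((cmDatum L N H).toAdelic (Quotient.out c))) : (cmDatum L N H).Adelic)))) ∧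
      IsFiniteMeasureOnCompacts (mG v (ConjClasses.mk ((cmDatum L N H).toLocal v
        (Quotient.out (ConjClasses.mk ((cmDatum L N H).toAdelic (Quotient.out c))) : (cmDatum L N H).Adelic)))))
    (hadmA : ∀ c, P c →
      mGi (ConjClasses.mk (archPart (↥(maximalRealSubfield L)) L (IsCMField.complexConj L) N H
        (Quotient.out (ConjClasses.mk ((cmDatum L N H).toAdelic (Quotient.out c))) : (cmDatum L N H).Adelic))) ≠ 0 ∧
      SMulInvariantMeasure (arch (↥(maximalRealSubfield L)) L (IsCMField.complexConj L) N H) _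
        (mGi (ConjClasses.mk (archPart (↥(maximalRealSubfield L)) L (IsCMField.complexConj L) N H
          (Quotient.out (ConjClasses.mk ((cmDatum L N H).toAdelic (Quotient.out c))) : (cmDatum L N H).Adelic)))) ∧
      IsFiniteMeasureOnCompacts (mGi (ConjClasses.mk (archPart (↥(maximalRealSubfield L)) L (IsCMField.complexConj L) N H
          (Quotient.out (ConjClasses.mk ((cmDatum L N H).toAdelic (Quotient.out c))) : (cmDatum L N H).Adelic))))) :
    ∃ t : ∀ c : ConjClasses (cmDatum L N H).Rational,
        Measure ↥(Subgroup.centralizer ({(cmDatum L N H).toAdelic (Quotient.out c)} : Set (cmDatum L N H).Adelic)),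
      ∃ (_ : ∀ c, (t c).IsHaarMeasure),
        ∀ c, P c → ∃ (_ : (t c).IsInvInvariant),
          (OrbitalMeasureFamily.ofLocalAdelic L N H mG mGi).atPoint ((cmDatum L N H).toAdelic (Quotient.out c)) =
            quotientMeasure (Subgroup.centralizer ({(cmDatum L N H).toAdelic (Quotient.out c)} : Set (cmDatum L N H).Adelic)) (t c)
              (Set.isClosed_centralizer _) ν :=
  OrbitalMeasureFamily.exists_haarFamily_atPoint_eq_quotientMeasure_on (cmDatum L N H).toAdelic (fun _ => Set.isClosed_centralizer _) ν P hinv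
    (OrbitalMeasureFamily.ofLocalAdelic L N H mG mGi) fun c hc =>
      OrbitalMeasureFamily.ofLocalAdelic_admissible L N H mG mGi (ConjClasses.mk ((cmDatum L N H).toAdelic (Quotient.out c)))
        (hS₀ c hc) (hadm c hc) (hadmA c hc)

/-! ## §2 `H` anisotropic: `ofLocal` is a Weil quotient at EVERY rational class -/

/-- **`H` ANISOTROPIC: `ofLocal mG mGi` is a family of Weil quotients `dν ∕ d(t c)` at ALL rational classes** where the local data are admissible and
normalised (Haar measures of `U(H)(𝔸)_γ`, `γ` rational, are two-sided and inversion invariant: ★ `isMulRightInvariant_centralizer_cmDatum`, ★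
`isInvInvariant_centralizer_cmDatum` — `U(H)(L⁺)_γ` is a cocompact lattice).  The `ofLocal` reading of ★ `UnitaryGroup.exists_haarFamily_eq_quotientMeasure`
(`UnitaryGroupDiagTraceExplicitWeights` §2). [cite: Rogawski1990, §14.5 pp. 237–238] [cite: DeitmarEchterhoff2014, Thm. 1.5.3] -/
theorem exists_haarFamily_ofLocal_eq_quotientMeasure_of_anisotropic (hanis : ∀ x : Fin N → L, hermForm (cmConjRingHom L) H x x = 0 → x = 0)
    (P : ConjClasses (cmDatum L N H).Rational → Prop)
    (S₀ : ConjClasses (cmDatum L N H).Rational → Finset (HeightOneSpectrum (𝓞 ↥(maximalRealSubfield L))))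
    (hS₀ : ∀ c, P c → IsNormalisedOff L N H mG ((cmDatum L N H).toAdelic (Quotient.out c)) (S₀ c))
    (hadm : ∀ c, P c → ∀ v, mG v (ConjClasses.mk ((cmDatum L N H).toLocal v ((cmDatum L N H).toAdelic (Quotient.out c)))) ≠ 0 ∧
      SMulInvariantMeasure ((cmDatum L N H).Local v) _ (mG v (ConjClasses.mk ((cmDatum L N H).toLocal v ((cmDatum L N H).toAdelic (Quotient.out c))))) ∧
      IsFiniteMeasureOnCompacts (mG v (ConjClasses.mk ((cmDatum L N H).toLocal v ((cmDatum L N H).toAdelic (Quotient.out c))))))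
    (hadmA : ∀ c, P c →
      mGi (ConjClasses.mk (archPart (↥(maximalRealSubfield L)) L (IsCMField.complexConj L) N H ((cmDatum L N H).toAdelic (Quotient.out c)))) ≠ 0 ∧
      SMulInvariantMeasure (arch (↥(maximalRealSubfield L)) L (IsCMField.complexConj L) N H) _
        (mGi (ConjClasses.mk (archPart (↥(maximalRealSubfield L)) L (IsCMField.complexConj L) N H ((cmDatum L N H).toAdelic (Quotient.out c))))) ∧
      IsFiniteMeasureOnCompacts
        (mGi (ConjClasses.mk (archPart (↥(maximalRealSubfield L)) L (IsCMField.complexConj L) N H ((cmDatum L N H).toAdelic (Quotient.out c)))))) :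
    ∃ t : ∀ c : ConjClasses (cmDatum L N H).Rational,
        Measure ↥(Subgroup.centralizer ({(cmDatum L N H).toAdelic (Quotient.out c)} : Set (cmDatum L N H).Adelic)),
      ∃ (_ : ∀ c, (t c).IsHaarMeasure),
        ∀ c, P c → ∃ (_ : (t c).IsMulRightInvariant) (_ : (t c).IsInvInvariant),
          AdelicOrbitalMeasureFamily.ofLocal L N H mG mGi c =
            quotientMeasure (Subgroup.centralizer ({(cmDatum L N H).toAdelic (Quotient.out c)} : Set (cmDatum L N H).Adelic)) (t c)
              (Set.isClosed_centralizer _) ν := by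
  have hγ : ∀ c : ConjClasses (cmDatum L N H).Rational, (cmDatum L N H).toAdelic (Quotient.out c) ∈ (cmDatum L N H).arithmeticSubgroup :=
    fun c => ⟨Quotient.out c, rfl⟩
  obtain ⟨t, ht, hP⟩ := exists_haarFamily_ofLocal_eq_quotientMeasure_on L N H mG mGi ν P
    (fun c _ t ht => by
      haveI := ht
      haveI : IsClosed ((Subgroup.centralizer ({(cmDatum L N H).toAdelic (Quotient.out c)} : Set (cmDatum L N H).Adelic) :
        Subgroup (cmDatum L N H).Adelic) : Set (cmDatum L N H).Adelic) := Set.isClosed_centralizer _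
      exact isInvInvariant_centralizer_cmDatum L N H hanis (hγ c) t)
    S₀ hS₀ hadm hadmA
  refine ⟨t, ht, fun c hc => ?_⟩
  obtain ⟨hti, hm⟩ := hP c hc
  haveI := ht c
  exact ⟨isMulRightInvariant_centralizer_cmDatum L N H hanis (hγ c) (t c), hti, hm⟩

end AnyForm

/-! ## §3 The quasi-split `U(J₃) = cmDatum L 3 ((StdForm.antidiagonal 3).over L)` (`= quasiSplit L⁺ L c 3`, ★ `quasiSplit_eq_cmDatum` `rfl`):
`ofLocal` is a Weil quotient at the ELLIPTIC classes — the laws' `hm` at `m := ofLocal … mq mqi` -/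

section QuasiSplitThree

variable (L : Type) [Field L] [NumberField L] [IsCMField L]
  [MeasurableSpace (cmDatum L 3 ((StdForm.antidiagonal 3).over L)).Adelic] [BorelSpace (cmDatum L 3 ((StdForm.antidiagonal 3).over L)).Adelic]
  [∀ g : (cmDatum L 3 ((StdForm.antidiagonal 3).over L)).Adelic, MeasurableSpace ((cmDatum L 3 ((StdForm.antidiagonal 3).over L)).Adelic ⧸
    Subgroup.centralizer ({g} : Set (cmDatum L 3 ((StdForm.antidiagonal 3).over L)).Adelic))]
  [∀ g : (cmDatum L 3 ((StdForm.antidiagonal 3).over L)).Adelic, BorelSpace ((cmDatum L 3 ((StdForm.antidiagonal 3).over L)).Adelic ⧸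
    Subgroup.centralizer ({g} : Set (cmDatum L 3 ((StdForm.antidiagonal 3).over L)).Adelic))]
  [∀ a : arch (↥(maximalRealSubfield L)) L (IsCMField.complexConj L) 3 ((StdForm.antidiagonal 3).over L),
    MeasurableSpace (arch (↥(maximalRealSubfield L)) L (IsCMField.complexConj L) 3 ((StdForm.antidiagonal 3).over L) ⧸
      Subgroup.centralizer ({a} : Set (arch (↥(maximalRealSubfield L)) L (IsCMField.complexConj L) 3 ((StdForm.antidiagonal 3).over L))))]
  [∀ a : arch (↥(maximalRealSubfield L)) L (IsCMField.complexConj L) 3 ((StdForm.antidiagonal 3).over L),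
    BorelSpace (arch (↥(maximalRealSubfield L)) L (IsCMField.complexConj L) 3 ((StdForm.antidiagonal 3).over L) ⧸
      Subgroup.centralizer ({a} : Set (arch (↥(maximalRealSubfield L)) L (IsCMField.complexConj L) 3 ((StdForm.antidiagonal 3).over L))))]
  [∀ (v : HeightOneSpectrum (𝓞 ↥(maximalRealSubfield L))) (x : (cmDatum L 3 ((StdForm.antidiagonal 3).over L)).Local v),
    MeasurableSpace ((cmDatum L 3 ((StdForm.antidiagonal 3).over L)).Local v ⧸
      Subgroup.centralizer ({x} : Set ((cmDatum L 3 ((StdForm.antidiagonal 3).over L)).Local v)))]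
  [∀ (v : HeightOneSpectrum (𝓞 ↥(maximalRealSubfield L))) (x : (cmDatum L 3 ((StdForm.antidiagonal 3).over L)).Local v),
    BorelSpace ((cmDatum L 3 ((StdForm.antidiagonal 3).over L)).Local v ⧸
      Subgroup.centralizer ({x} : Set ((cmDatum L 3 ((StdForm.antidiagonal 3).over L)).Local v)))]
  (mq : ∀ v : HeightOneSpectrum (𝓞 ↥(maximalRealSubfield L)), OrbitalMeasureFamily ((cmDatum L 3 ((StdForm.antidiagonal 3).over L)).Local v))
  (mqi : OrbitalMeasureFamily (arch (↥(maximalRealSubfield L)) L (IsCMField.complexConj L) 3 ((StdForm.antidiagonal 3).over L)))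
  (ν : Measure (cmDatum L 3 ((StdForm.antidiagonal 3).over L)).Adelic) [ν.IsHaarMeasure] [ν.IsMulRightInvariant]

/-- **THE LAWS' `hm` AT `m := ofLocal … mq mqi` (`U(J₃)`, CM pair).**  For a conjugation-invariant class map `cl` on `G(L⁺)·1` and local ∕ archimedean
class-indexed families `mq v`, `mqi` of the quasi-split `G = U(J₃)` that are admissible at the local classes of `γ_c·1` and normalised off `S₀ c` at every
ELLIPTIC class `c` (`∀ β ∈ B(L⁺), cl β ≠ cl (γ_c·1)`): there are Haar measures `νR c` on ALL the centralisers `G(𝔸)_{γ_c·1}` such that at every elliptic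
`c`, `νR c` is right and inversion invariant and `AdelicOrbitalMeasureFamily.ofLocal L 3 Φ₃ mq mqi c = quotientMeasure (G(𝔸)_{γ_c·1}) (νR c) ν` — §1 with
`hinv` := ★ `isInvInvariant_centralizer_of_forall_cl_ne` (elliptic centralisers are unimodular; `c² = 1` by ★ `complexConj_mul_complexConj`; the binder
`[ν.IsMulRightInvariant]` is the laws' own `haveI` ★ `isMulRightInvariant_quasiSplit_cm_three`). [cite: Rogawski1990, §2.2 p. 13; §5.4 (5.4.3) pp. 71–73] [cite: DeitmarEchterhoff2014, Thm. 1.5.3] -/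
theorem exists_haarFamily_ofLocal_eq_quotientMeasure_of_forall_cl_ne_cm {ι : Type*}
    {cl : (quasiSplit (↥(maximalRealSubfield L)) L (IsCMField.complexConj L) 3).arithmeticSubgroup → ι} (hcl : IsConjInvariant cl)
    (S₀ : ConjClasses (cmDatum L 3 ((StdForm.antidiagonal 3).over L)).Rational → Finset (HeightOneSpectrum (𝓞 ↥(maximalRealSubfield L))))
    (hS₀ : ∀ c : ConjClasses (cmDatum L 3 ((StdForm.antidiagonal 3).over L)).Rational,
      (∀ β : arithmeticBorel (↥(maximalRealSubfield L)) L (IsCMField.complexConj L) 3,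
          cl β ≠ cl ⟨(quasiSplit (↥(maximalRealSubfield L)) L (IsCMField.complexConj L) 3).toAdelic (Quotient.out c), Quotient.out c, rfl⟩) →
        IsNormalisedOff L 3 ((StdForm.antidiagonal 3).over L) mq
          ((cmDatum L 3 ((StdForm.antidiagonal 3).over L)).toAdelic (Quotient.out c)) (S₀ c))
    (hadm : ∀ c : ConjClasses (cmDatum L 3 ((StdForm.antidiagonal 3).over L)).Rational,
      (∀ β : arithmeticBorel (↥(maximalRealSubfield L)) L (IsCMField.complexConj L) 3,
          cl β ≠ cl ⟨(quasiSplit (↥(maximalRealSubfield L)) L (IsCMField.complexConj L) 3).toAdelic (Quotient.out c), Quotient.out c, rfl⟩) →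
        ∀ v, mq v (ConjClasses.mk ((cmDatum L 3 ((StdForm.antidiagonal 3).over L)).toLocal v
            ((cmDatum L 3 ((StdForm.antidiagonal 3).over L)).toAdelic (Quotient.out c)))) ≠ 0 ∧
          SMulInvariantMeasure ((cmDatum L 3 ((StdForm.antidiagonal 3).over L)).Local v) _
            (mq v (ConjClasses.mk ((cmDatum L 3 ((StdForm.antidiagonal 3).over L)).toLocal v
              ((cmDatum L 3 ((StdForm.antidiagonal 3).over L)).toAdelic (Quotient.out c))))) ∧
          IsFiniteMeasureOnCompacts (mq v (ConjClasses.mk ((cmDatum L 3 ((StdForm.antidiagonal 3).over L)).toLocal v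
              ((cmDatum L 3 ((StdForm.antidiagonal 3).over L)).toAdelic (Quotient.out c))))))
    (hadmA : ∀ c : ConjClasses (cmDatum L 3 ((StdForm.antidiagonal 3).over L)).Rational,
      (∀ β : arithmeticBorel (↥(maximalRealSubfield L)) L (IsCMField.complexConj L) 3,
          cl β ≠ cl ⟨(quasiSplit (↥(maximalRealSubfield L)) L (IsCMField.complexConj L) 3).toAdelic (Quotient.out c), Quotient.out c, rfl⟩) →
        mqi (ConjClasses.mk (archPart (↥(maximalRealSubfield L)) L (IsCMField.complexConj L) 3 ((StdForm.antidiagonal 3).over L)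
            ((cmDatum L 3 ((StdForm.antidiagonal 3).over L)).toAdelic (Quotient.out c)))) ≠ 0 ∧
          SMulInvariantMeasure (arch (↥(maximalRealSubfield L)) L (IsCMField.complexConj L) 3 ((StdForm.antidiagonal 3).over L)) _
            (mqi (ConjClasses.mk (archPart (↥(maximalRealSubfield L)) L (IsCMField.complexConj L) 3 ((StdForm.antidiagonal 3).over L)
              ((cmDatum L 3 ((StdForm.antidiagonal 3).over L)).toAdelic (Quotient.out c))))) ∧
          IsFiniteMeasureOnCompacts (mqi (ConjClasses.mk (archPart (↥(maximalRealSubfield L)) L (IsCMField.complexConj L) 3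
              ((StdForm.antidiagonal 3).over L) ((cmDatum L 3 ((StdForm.antidiagonal 3).over L)).toAdelic (Quotient.out c)))))) :
    ∃ νR : ∀ c : ConjClasses (cmDatum L 3 ((StdForm.antidiagonal 3).over L)).Rational,
        Measure ↥(Subgroup.centralizer ({(cmDatum L 3 ((StdForm.antidiagonal 3).over L)).toAdelic (Quotient.out c)} :
          Set (cmDatum L 3 ((StdForm.antidiagonal 3).over L)).Adelic)),
      ∃ (_ : ∀ c, (νR c).IsHaarMeasure),
        ∀ c : ConjClasses (cmDatum L 3 ((StdForm.antidiagonal 3).over L)).Rational,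
          (∀ β : arithmeticBorel (↥(maximalRealSubfield L)) L (IsCMField.complexConj L) 3,
              cl β ≠ cl ⟨(quasiSplit (↥(maximalRealSubfield L)) L (IsCMField.complexConj L) 3).toAdelic (Quotient.out c), Quotient.out c, rfl⟩) →
            ∃ (_ : (νR c).IsMulRightInvariant) (_ : (νR c).IsInvInvariant),
              AdelicOrbitalMeasureFamily.ofLocal L 3 ((StdForm.antidiagonal 3).over L) mq mqi c =
                quotientMeasure (Subgroup.centralizer ({(cmDatum L 3 ((StdForm.antidiagonal 3).over L)).toAdelic (Quotient.out c)} :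
                  Set (cmDatum L 3 ((StdForm.antidiagonal 3).over L)).Adelic)) (νR c) (Set.isClosed_centralizer _) ν := by
  -- re-letter the two σ-algebra instances for the `quasiSplit`-lettered unimodularity letters (`quasiSplit_eq_cmDatum` is `rfl`)
  letI : MeasurableSpace (quasiSplit (↥(maximalRealSubfield L)) L (IsCMField.complexConj L) 3).Adelic :=
    ‹MeasurableSpace (cmDatum L 3 ((StdForm.antidiagonal 3).over L)).Adelic›
  haveI : BorelSpace (quasiSplit (↥(maximalRealSubfield L)) L (IsCMField.complexConj L) 3).Adelic :=
    ‹BorelSpace (cmDatum L 3 ((StdForm.antidiagonal 3).over L)).Adelic›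
  obtain ⟨t, ht, hP⟩ := exists_haarFamily_ofLocal_eq_quotientMeasure_on L 3 ((StdForm.antidiagonal 3).over L) mq mqi ν
    (fun c => ∀ β : arithmeticBorel (↥(maximalRealSubfield L)) L (IsCMField.complexConj L) 3,
      cl β ≠ cl ⟨(quasiSplit (↥(maximalRealSubfield L)) L (IsCMField.complexConj L) 3).toAdelic (Quotient.out c), Quotient.out c, rfl⟩)
    (fun c hc t ht => by
      -- the Haar instance, re-lettered onto the `quasiSplit` centraliser (same term by `rfl`)
      haveI : (show Measure ↥(Subgroup.centralizer
          ({(quasiSplit (↥(maximalRealSubfield L)) L (IsCMField.complexConj L) 3).toAdelic (Quotient.out c)} :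
            Set (quasiSplit (↥(maximalRealSubfield L)) L (IsCMField.complexConj L) 3).Adelic)) from t).IsHaarMeasure := ht
      exact isInvInvariant_centralizer_of_forall_cl_ne (complexConj_mul_complexConj L) hcl hc
        (γ := ⟨(quasiSplit (↥(maximalRealSubfield L)) L (IsCMField.complexConj L) 3).toAdelic (Quotient.out c), Quotient.out c, rfl⟩) rfl
        (show Measure ↥(Subgroup.centralizer
          ({(quasiSplit (↥(maximalRealSubfield L)) L (IsCMField.complexConj L) 3).toAdelic (Quotient.out c)} :
            Set (quasiSplit (↥(maximalRealSubfield L)) L (IsCMField.complexConj L) 3).Adelic)) from t))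
    S₀ hS₀ hadm hadmA
  refine ⟨t, ht, fun c hc => ?_⟩
  obtain ⟨hti, hm⟩ := hP c hc
  haveI : (show Measure ↥(Subgroup.centralizer
      ({(quasiSplit (↥(maximalRealSubfield L)) L (IsCMField.complexConj L) 3).toAdelic (Quotient.out c)} :
        Set (quasiSplit (↥(maximalRealSubfield L)) L (IsCMField.complexConj L) 3).Adelic)) from t c).IsHaarMeasure := ht c
  exact ⟨isMulRightInvariant_centralizer_of_forall_cl_ne (complexConj_mul_complexConj L) hcl hc
    (γ := ⟨(quasiSplit (↥(maximalRealSubfield L)) L (IsCMField.complexConj L) 3).toAdelic (Quotient.out c), Quotient.out c, rfl⟩) rfl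
    (show Measure ↥(Subgroup.centralizer
      ({(quasiSplit (↥(maximalRealSubfield L)) L (IsCMField.complexConj L) 3).toAdelic (Quotient.out c)} :
        Set (quasiSplit (↥(maximalRealSubfield L)) L (IsCMField.complexConj L) 3).Adelic)) from t c),
    hti, hm⟩

end QuasiSplitThree
/-! ## §4 The quasi-split `U(J₂) = cmDatum L 2 ((StdForm.antidiagonal 2).over L)` — the `U(Φ₂)` factor of `H`: `ofLocal` at the ELLIPTIC classes -/

section QuasiSplitTwo

variable (L : Type) [Field L] [NumberField L] [IsCMField L]
  [MeasurableSpace (cmDatum L 2 ((StdForm.antidiagonal 2).over L)).Adelic] [BorelSpace (cmDatum L 2 ((StdForm.antidiagonal 2).over L)).Adelic]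
  [∀ g : (cmDatum L 2 ((StdForm.antidiagonal 2).over L)).Adelic, MeasurableSpace ((cmDatum L 2 ((StdForm.antidiagonal 2).over L)).Adelic ⧸
    Subgroup.centralizer ({g} : Set (cmDatum L 2 ((StdForm.antidiagonal 2).over L)).Adelic))]
  [∀ g : (cmDatum L 2 ((StdForm.antidiagonal 2).over L)).Adelic, BorelSpace ((cmDatum L 2 ((StdForm.antidiagonal 2).over L)).Adelic ⧸
    Subgroup.centralizer ({g} : Set (cmDatum L 2 ((StdForm.antidiagonal 2).over L)).Adelic))]
  [∀ a : arch (↥(maximalRealSubfield L)) L (IsCMField.complexConj L) 2 ((StdForm.antidiagonal 2).over L),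
    MeasurableSpace (arch (↥(maximalRealSubfield L)) L (IsCMField.complexConj L) 2 ((StdForm.antidiagonal 2).over L) ⧸
      Subgroup.centralizer ({a} : Set (arch (↥(maximalRealSubfield L)) L (IsCMField.complexConj L) 2 ((StdForm.antidiagonal 2).over L))))]
  [∀ a : arch (↥(maximalRealSubfield L)) L (IsCMField.complexConj L) 2 ((StdForm.antidiagonal 2).over L),
    BorelSpace (arch (↥(maximalRealSubfield L)) L (IsCMField.complexConj L) 2 ((StdForm.antidiagonal 2).over L) ⧸
      Subgroup.centralizer ({a} : Set (arch (↥(maximalRealSubfield L)) L (IsCMField.complexConj L) 2 ((StdForm.antidiagonal 2).over L))))]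
  [∀ (v : HeightOneSpectrum (𝓞 ↥(maximalRealSubfield L))) (x : (cmDatum L 2 ((StdForm.antidiagonal 2).over L)).Local v),
    MeasurableSpace ((cmDatum L 2 ((StdForm.antidiagonal 2).over L)).Local v ⧸
      Subgroup.centralizer ({x} : Set ((cmDatum L 2 ((StdForm.antidiagonal 2).over L)).Local v)))]
  [∀ (v : HeightOneSpectrum (𝓞 ↥(maximalRealSubfield L))) (x : (cmDatum L 2 ((StdForm.antidiagonal 2).over L)).Local v),
    BorelSpace ((cmDatum L 2 ((StdForm.antidiagonal 2).over L)).Local v ⧸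
      Subgroup.centralizer ({x} : Set ((cmDatum L 2 ((StdForm.antidiagonal 2).over L)).Local v)))]
  (mq : ∀ v : HeightOneSpectrum (𝓞 ↥(maximalRealSubfield L)), OrbitalMeasureFamily ((cmDatum L 2 ((StdForm.antidiagonal 2).over L)).Local v))
  (mqi : OrbitalMeasureFamily (arch (↥(maximalRealSubfield L)) L (IsCMField.complexConj L) 2 ((StdForm.antidiagonal 2).over L)))
  (ν : Measure (cmDatum L 2 ((StdForm.antidiagonal 2).over L)).Adelic) [ν.IsHaarMeasure] [ν.IsMulRightInvariant]

/-- **THE `…Two` LAWS' `hm` AT `m := ofLocal … mq mqi` (`U(J₂)`, the `U(Φ₂)` factor of `H = U(Φ₂) × U(Φ₁)`, CM pair; A-p16's (R2)).**  As §3 at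
`N = 2`: at every elliptic class of `U(J₂)(L⁺)` (`∀ β ∈ B(L⁺), cl β ≠ cl (γ_c·1)`) where `mq v`, `mqi` are admissible and normalised off `S₀ c`,
`ofLocal L 2 Φ₂ mq mqi c = quotientMeasure (G(𝔸)_{γ_c·1}) (νR c) ν` for a TOTAL Haar family `νR`, right ∕ inversion invariant there (★
`isMulRightInvariant_centralizer_of_forall_cl_ne_two`, ★ `isInvInvariant_centralizer_of_forall_cl_ne_two`; no `c² = 1` needed; the binder
`[ν.IsMulRightInvariant]` is the laws' `haveI` ★ `isMulRightInvariant_quasiSplit_cm_two`). [cite: Rogawski1990, §2.2 p. 13; §5.4 (5.4.3) pp. 71–73]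
[cite: DeitmarEchterhoff2014, Thm. 1.5.3] -/
theorem exists_haarFamily_ofLocal_eq_quotientMeasure_of_forall_cl_ne_cm_two {ι : Type*}
    {cl : (quasiSplit (↥(maximalRealSubfield L)) L (IsCMField.complexConj L) 2).arithmeticSubgroup → ι} (hcl : IsConjInvariant cl)
    (S₀ : ConjClasses (cmDatum L 2 ((StdForm.antidiagonal 2).over L)).Rational → Finset (HeightOneSpectrum (𝓞 ↥(maximalRealSubfield L))))
    (hS₀ : ∀ c : ConjClasses (cmDatum L 2 ((StdForm.antidiagonal 2).over L)).Rational,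
      (∀ β : arithmeticBorel (↥(maximalRealSubfield L)) L (IsCMField.complexConj L) 2,
          cl β ≠ cl ⟨(quasiSplit (↥(maximalRealSubfield L)) L (IsCMField.complexConj L) 2).toAdelic (Quotient.out c), Quotient.out c, rfl⟩) →
        IsNormalisedOff L 2 ((StdForm.antidiagonal 2).over L) mq
          ((cmDatum L 2 ((StdForm.antidiagonal 2).over L)).toAdelic (Quotient.out c)) (S₀ c))
    (hadm : ∀ c : ConjClasses (cmDatum L 2 ((StdForm.antidiagonal 2).over L)).Rational,
      (∀ β : arithmeticBorel (↥(maximalRealSubfield L)) L (IsCMField.complexConj L) 2,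
          cl β ≠ cl ⟨(quasiSplit (↥(maximalRealSubfield L)) L (IsCMField.complexConj L) 2).toAdelic (Quotient.out c), Quotient.out c, rfl⟩) →
        ∀ v, mq v (ConjClasses.mk ((cmDatum L 2 ((StdForm.antidiagonal 2).over L)).toLocal v
            ((cmDatum L 2 ((StdForm.antidiagonal 2).over L)).toAdelic (Quotient.out c)))) ≠ 0 ∧
          SMulInvariantMeasure ((cmDatum L 2 ((StdForm.antidiagonal 2).over L)).Local v) _
            (mq v (ConjClasses.mk ((cmDatum L 2 ((StdForm.antidiagonal 2).over L)).toLocal v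
              ((cmDatum L 2 ((StdForm.antidiagonal 2).over L)).toAdelic (Quotient.out c))))) ∧
          IsFiniteMeasureOnCompacts (mq v (ConjClasses.mk ((cmDatum L 2 ((StdForm.antidiagonal 2).over L)).toLocal v
              ((cmDatum L 2 ((StdForm.antidiagonal 2).over L)).toAdelic (Quotient.out c))))))
    (hadmA : ∀ c : ConjClasses (cmDatum L 2 ((StdForm.antidiagonal 2).over L)).Rational,
      (∀ β : arithmeticBorel (↥(maximalRealSubfield L)) L (IsCMField.complexConj L) 2,
          cl β ≠ cl ⟨(quasiSplit (↥(maximalRealSubfield L)) L (IsCMField.complexConj L) 2).toAdelic (Quotient.out c), Quotient.out c, rfl⟩) →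
        mqi (ConjClasses.mk (archPart (↥(maximalRealSubfield L)) L (IsCMField.complexConj L) 2 ((StdForm.antidiagonal 2).over L)
            ((cmDatum L 2 ((StdForm.antidiagonal 2).over L)).toAdelic (Quotient.out c)))) ≠ 0 ∧
          SMulInvariantMeasure (arch (↥(maximalRealSubfield L)) L (IsCMField.complexConj L) 2 ((StdForm.antidiagonal 2).over L)) _
            (mqi (ConjClasses.mk (archPart (↥(maximalRealSubfield L)) L (IsCMField.complexConj L) 2 ((StdForm.antidiagonal 2).over L)
              ((cmDatum L 2 ((StdForm.antidiagonal 2).over L)).toAdelic (Quotient.out c))))) ∧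
          IsFiniteMeasureOnCompacts (mqi (ConjClasses.mk (archPart (↥(maximalRealSubfield L)) L (IsCMField.complexConj L) 2
              ((StdForm.antidiagonal 2).over L) ((cmDatum L 2 ((StdForm.antidiagonal 2).over L)).toAdelic (Quotient.out c)))))) :
    ∃ νR : ∀ c : ConjClasses (cmDatum L 2 ((StdForm.antidiagonal 2).over L)).Rational,
        Measure ↥(Subgroup.centralizer ({(cmDatum L 2 ((StdForm.antidiagonal 2).over L)).toAdelic (Quotient.out c)} :
          Set (cmDatum L 2 ((StdForm.antidiagonal 2).over L)).Adelic)),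
      ∃ (_ : ∀ c, (νR c).IsHaarMeasure),
        ∀ c : ConjClasses (cmDatum L 2 ((StdForm.antidiagonal 2).over L)).Rational,
          (∀ β : arithmeticBorel (↥(maximalRealSubfield L)) L (IsCMField.complexConj L) 2,
              cl β ≠ cl ⟨(quasiSplit (↥(maximalRealSubfield L)) L (IsCMField.complexConj L) 2).toAdelic (Quotient.out c), Quotient.out c, rfl⟩) →
            ∃ (_ : (νR c).IsMulRightInvariant) (_ : (νR c).IsInvInvariant),
              AdelicOrbitalMeasureFamily.ofLocal L 2 ((StdForm.antidiagonal 2).over L) mq mqi c =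
                quotientMeasure (Subgroup.centralizer ({(cmDatum L 2 ((StdForm.antidiagonal 2).over L)).toAdelic (Quotient.out c)} :
                  Set (cmDatum L 2 ((StdForm.antidiagonal 2).over L)).Adelic)) (νR c) (Set.isClosed_centralizer _) ν := by
  -- re-letter the two σ-algebra instances for the `quasiSplit`-lettered unimodularity letters (`quasiSplit_eq_cmDatum` is `rfl`)
  letI : MeasurableSpace (quasiSplit (↥(maximalRealSubfield L)) L (IsCMField.complexConj L) 2).Adelic :=
    ‹MeasurableSpace (cmDatum L 2 ((StdForm.antidiagonal 2).over L)).Adelic›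
  haveI : BorelSpace (quasiSplit (↥(maximalRealSubfield L)) L (IsCMField.complexConj L) 2).Adelic :=
    ‹BorelSpace (cmDatum L 2 ((StdForm.antidiagonal 2).over L)).Adelic›
  obtain ⟨t, ht, hP⟩ := exists_haarFamily_ofLocal_eq_quotientMeasure_on L 2 ((StdForm.antidiagonal 2).over L) mq mqi ν
    (fun c => ∀ β : arithmeticBorel (↥(maximalRealSubfield L)) L (IsCMField.complexConj L) 2,
      cl β ≠ cl ⟨(quasiSplit (↥(maximalRealSubfield L)) L (IsCMField.complexConj L) 2).toAdelic (Quotient.out c), Quotient.out c, rfl⟩)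
    (fun c hc t ht => by
      -- the Haar instance, re-lettered onto the `quasiSplit` centraliser (same term by `rfl`)
      haveI : (show Measure ↥(Subgroup.centralizer
          ({(quasiSplit (↥(maximalRealSubfield L)) L (IsCMField.complexConj L) 2).toAdelic (Quotient.out c)} :
            Set (quasiSplit (↥(maximalRealSubfield L)) L (IsCMField.complexConj L) 2).Adelic)) from t).IsHaarMeasure := ht
      exact isInvInvariant_centralizer_of_forall_cl_ne_two hcl hc
        (γ := ⟨(quasiSplit (↥(maximalRealSubfield L)) L (IsCMField.complexConj L) 2).toAdelic (Quotient.out c), Quotient.out c, rfl⟩) rfl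
        (show Measure ↥(Subgroup.centralizer
          ({(quasiSplit (↥(maximalRealSubfield L)) L (IsCMField.complexConj L) 2).toAdelic (Quotient.out c)} :
            Set (quasiSplit (↥(maximalRealSubfield L)) L (IsCMField.complexConj L) 2).Adelic)) from t))
    S₀ hS₀ hadm hadmA
  refine ⟨t, ht, fun c hc => ?_⟩
  obtain ⟨hti, hm⟩ := hP c hc
  haveI : (show Measure ↥(Subgroup.centralizer
      ({(quasiSplit (↥(maximalRealSubfield L)) L (IsCMField.complexConj L) 2).toAdelic (Quotient.out c)} :
        Set (quasiSplit (↥(maximalRealSubfield L)) L (IsCMField.complexConj L) 2).Adelic)) from t c).IsHaarMeasure := ht c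
  exact ⟨isMulRightInvariant_centralizer_of_forall_cl_ne_two hcl hc
    (γ := ⟨(quasiSplit (↥(maximalRealSubfield L)) L (IsCMField.complexConj L) 2).toAdelic (Quotient.out c), Quotient.out c, rfl⟩) rfl
    (show Measure ↥(Subgroup.centralizer
      ({(quasiSplit (↥(maximalRealSubfield L)) L (IsCMField.complexConj L) 2).toAdelic (Quotient.out c)} :
        Set (quasiSplit (↥(maximalRealSubfield L)) L (IsCMField.complexConj L) 2).Adelic)) from t c),
    hti, hm⟩

end QuasiSplitTwo

end UnitaryGroup
end Literature.NumberTheory.Automorphic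
end
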